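import Summits.AtomisticToContinuum.HydrodynamicLimit.Theorems.AntiMazurCoboundariesTransferSkeletonTools
import Summits.AtomisticToContinuum.HydrodynamicLimit.Theorems.AntiMazurCoboundariesPressureCertificateTransfer
import Literature.Analysis.FluidPDE.HardSphereFlowJointMeasurable

/-!
# Window locality, core inequalities: true kinetic window versus forecast window, modulo bad particles

Route `AntiMazurCoboundaries` of `AtomisticToContinuum/HydrodynamicLimit`, crux stmt-AtomisticToContinuum-14135
(`CorrectorPressureDecay`, "X"), line `almost-invariant-duality`, lead seat c6 — the WINDOW ROUTE of layer 2.

For ONE hard-sphere flow `Φ` on `𝕋³`, one family `Ψ` of cluster flows, one law `μ` carried by the good set of `Φ`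
(no invariance is needed here), one bounded one-body observable `f` (`|f| ≤ C`) and its double `f₂ = 2f`, a
window `H > 0` and a range `R`, the exponential moments of

* the TRUE kinetic-window functional `H⁻¹∫₀ᴴ Σᵢ f((Φ_t z)ᵢ) dt` (the integrand of the shared crux
  `KineticFluxLdDecay`, stmt-10967), and of
* the FORECAST-window functional `Σᵢ H⁻¹∫₀ᴴ f(ζ^{(i,R)}_t(z)) dt` (`ζ` = `localClusterState Ψ R`, the integrand of
  the forecast-window pressure `h₃` of `TransferSkeleton.correctorPressureDecay_of_inputs`)

dominate each other up to the exponential moment of `lam · #bad` for any `lam ≥ 4C`, `#bad` the number of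
particles whose true state leaves its range-`R` forecast before time `H` (the event of `InfluenceLocality`):

* `WindowLocality.wl_trueWindow_le` :
  `∫ e^{true(f)} dμ ≤ ½ (∫ e^{forecast(f₂)} dμ + ∫ e^{lam·#bad} dμ)`;
* `WindowLocality.wl_forecastWindow_le` :
  `∫ e^{forecast(f)} dμ ≤ ½ (∫ e^{true(f₂)} dμ + ∫ e^{lam·#bad} dμ)`.

Proof: on the good set the particle sum and the time integral commute
(`TransferSkeleton.intervalIntegral_sum` along the measurable orbit), the two window sums differ by at most
`2C·#bad` (`TransferSkeleton.abs_window_true_sub_forecast_le`), and `e^{a+b} ≤ ½(e^{2a} + e^{2b})` — the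
measurability-free substitute for Cauchy–Schwarz (the bad count is not known to be measurable; only ONE summand
of a `lintegral` of a sum has to be a.e.-measurable). The amplitude on `#bad` is `4C`, INDEPENDENT of the window
`H`: this is what distinguishes the window route from the corrector transfer, whose error term carries the
amplitude `12·H·C/s` (`TransferSkeleton.lintegral_exp_defect_le`, clause `bL₂`).

References: folklore (finite speed of influence bookkeeping); Kipnis–Landim (1999) Ch. 7 §2 for the role of
window functionals.
-/

noncomputable section

open MeasureTheory Set Filter Topology
open scoped ENNReal

namespace Summit.AtomisticToContinuum.HydrodynamicLimit.Theorems

open Literature.Analysis.FluidPDE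
open Literature.MathematicalPhysics.KineticTheory (T3 V3)

namespace WindowLocality

/-- AM–GM for two exponentials, in `ℝ≥0∞`: `e^{a+b} ≤ ½(e^{2a} + e^{2b})`. [folklore] -/
theorem ofReal_exp_add_le (a b : ℝ) :
    ENNReal.ofReal (Real.exp (a + b)) ≤
      2⁻¹ * (ENNReal.ofReal (Real.exp (2 * a)) + ENNReal.ofReal (Real.exp (2 * b))) := by
  have h := AntiMazurCertificate.exp_half_add_le (2 * a) (2 * b)
  have h2 : 2⁻¹ * (2 * a + 2 * b) = a + b := by ring
  rw [h2] at h
  calc ENNReal.ofReal (Real.exp (a + b))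
      ≤ ENNReal.ofReal (2⁻¹ * (Real.exp (2 * a) + Real.exp (2 * b))) := ENNReal.ofReal_le_ofReal h
    _ = 2⁻¹ * (ENNReal.ofReal (Real.exp (2 * a)) + ENNReal.ofReal (Real.exp (2 * b))) := by
        rw [ENNReal.ofReal_mul (by norm_num), ENNReal.ofReal_add (Real.exp_pos _).le (Real.exp_pos _).le,
          ENNReal.ofReal_inv_of_pos (by norm_num : (0 : ℝ) < 2), ENNReal.ofReal_ofNat]

/-- Monotonicity of the bad-count exponential in the amplitude: for `0 ≤ n` and `a ≤ lam`,
`e^{a n} ≤ e^{lam n}` in `ℝ≥0∞`. [folklore] -/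
theorem ofReal_exp_mul_le_of_le {a lam n : ℝ} (h : a ≤ lam) (hn : 0 ≤ n) :
    ENNReal.ofReal (Real.exp (a * n)) ≤ ENNReal.ofReal (Real.exp (lam * n)) :=
  ENNReal.ofReal_le_ofReal (Real.exp_le_exp.2 (mul_le_mul_of_nonneg_right h hn))

/-- `∫ ½(X + Y) ≤ ½(∫X + ∫Y)` (equality in fact) as soon as `X` is a.e.-measurable. [folklore] -/
theorem lintegral_half_add_le {α : Type*} [MeasurableSpace α] {μ : Measure α} {X Y : α → ℝ≥0∞}
    (hX : AEMeasurable X μ) :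
    ∫⁻ z, 2⁻¹ * (X z + Y z) ∂μ ≤ 2⁻¹ * (∫⁻ z, X z ∂μ + ∫⁻ z, Y z ∂μ) := by
  rw [lintegral_const_mul' _ _ (by simp), lintegral_add_left' hX]

variable {N : ℕ} {ε : ℝ}

/-- On a good orbit the particle sum and the window integral commute:
`H⁻¹∫₀ᴴ Σᵢ f((Φ_t z)ᵢ) dt = Σᵢ H⁻¹∫₀ᴴ f((Φ_t z)ᵢ) dt`. [folklore] -/
theorem trueWindow_eq_sum (Φ : HardSphereFlow (Torus.geometry (Fin 3)) ε N) {z : Config N (Fin 3) T3}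
    (hz : z ∈ Φ.good) {f : T3 × EuclideanSpace ℝ (Fin 3) → ℝ} (hfm : Measurable f) {C : ℝ}
    (hf : ∀ q, |f q| ≤ C) (H : ℝ) :
    H⁻¹ * ∫ t in (0 : ℝ)..H, ∑ i, f (Φ.flow t z i) = ∑ i, H⁻¹ * ∫ t in (0 : ℝ)..H, f (Φ.flow t z i) := by
  rw [TransferSkeleton.intervalIntegral_sum (fun t => Φ.flow t z)
    (AntiMazurCertificate.measurable_flow_orbit Φ hz) hfm hf 0 H, Finset.mul_sum]

/-- Doubling the observable doubles a window sum: `Σᵢ H⁻¹∫₀ᴴ f₂(γᵢ(t)) dt = 2 · Σᵢ H⁻¹∫₀ᴴ f(γᵢ(t)) dt`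
when `f₂ = 2f` (no integrability needed). [folklore] -/
theorem sum_window_double {f f₂ : T3 × EuclideanSpace ℝ (Fin 3) → ℝ} (hf₂ : ∀ q, f₂ q = 2 * f q)
    (γ : Fin N → ℝ → T3 × EuclideanSpace ℝ (Fin 3)) (H : ℝ) :
    ∑ i, H⁻¹ * ∫ t in (0 : ℝ)..H, f₂ (γ i t) = 2 * ∑ i, H⁻¹ * ∫ t in (0 : ℝ)..H, f (γ i t) := by
  rw [Finset.mul_sum]
  refine Finset.sum_congr rfl fun i _ => ?_
  simp_rw [hf₂]
  rw [intervalIntegral.integral_const_mul]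
  ring

/-- Doubling the observable doubles the true window functional (sum inside the integral). [folklore] -/
theorem trueWindow_double {f f₂ : T3 × EuclideanSpace ℝ (Fin 3) → ℝ} (hf₂ : ∀ q, f₂ q = 2 * f q)
    (γ : ℝ → Config N (Fin 3) T3) (H : ℝ) :
    H⁻¹ * ∫ t in (0 : ℝ)..H, ∑ i, f₂ (γ t i) = 2 * (H⁻¹ * ∫ t in (0 : ℝ)..H, ∑ i, f (γ t i)) := by
  have h : (fun t => ∑ i, f₂ (γ t i)) = fun t => 2 * ∑ i, f (γ t i) := by
    funext t
    rw [Finset.mul_sum]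
    exact Finset.sum_congr rfl fun i _ => hf₂ _
  rw [h, intervalIntegral.integral_const_mul]
  ring

open scoped Classical in
/-- **True window ≤ forecast window × locality (additive form).** For a law `μ` carried by the good set of
`Φ`, a measurable one-body observable `f` with `|f| ≤ C`, its double `f₂ = 2f` (measurable), a window `H > 0`,
a range `R` and an amplitude `lam ≥ 4C`:
`∫ exp(H⁻¹∫₀ᴴ Σᵢ f((Φ_t z)ᵢ) dt) dμ ≤ ½ (∫ exp(Σᵢ H⁻¹∫₀ᴴ f₂(ζ^{(i,R)}_t(z)) dt) dμ + ∫ exp(lam·#bad(z)) dμ)`.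
[folklore] -/
theorem wl_trueWindow_le : ∀ {N : ℕ} {ε : ℝ} (Φ : HardSphereFlow (Torus.geometry (Fin 3)) ε N)
    (Ψ : (k : ℕ) → HardSphereFlow (Torus.geometry (Fin 3)) ε k) (μ : Measure (Config N (Fin 3) T3)),
    μ Φ.goodᶜ = 0 → ∀ (f f₂ : T3 × EuclideanSpace ℝ (Fin 3) → ℝ) (C H R lam : ℝ), Measurable f →
    Measurable f₂ → (∀ q, |f q| ≤ C) → (∀ q, f₂ q = 2 * f q) → 0 < H → 4 * C ≤ lam →
    ∫⁻ z, ENNReal.ofReal (Real.exp (H⁻¹ * ∫ t in (0 : ℝ)..H, ∑ i, f (Φ.flow t z i))) ∂μ ≤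
      2⁻¹ * (∫⁻ z, ENNReal.ofReal (Real.exp (∑ i, H⁻¹ * ∫ t in (0 : ℝ)..H,
          f₂ (localClusterState Ψ R t z i))) ∂μ +
        ∫⁻ z, ENNReal.ofReal (Real.exp (lam * ((Finset.univ.filter fun i : Fin N =>
          ∃ t ∈ Set.Icc (0 : ℝ) H, Φ.flow t z i ≠ localClusterState Ψ R t z i).card : ℝ))) ∂μ) := by
  intro N ε Φ Ψ μ hgood f f₂ C H R lam hfm hf₂m hf hf₂ hH hlam
  classical
  have hae : ∀ᵐ z ∂μ, z ∈ Φ.good := mem_ae_iff.2 hgood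
  -- names
  set bad : Config N (Fin 3) T3 → ℝ := fun z => ((Finset.univ.filter fun i : Fin N =>
    ∃ t ∈ Set.Icc (0 : ℝ) H, Φ.flow t z i ≠ localClusterState Ψ R t z i).card : ℝ) with hbad
  set A₂ : Config N (Fin 3) T3 → ℝ := fun z => ∑ i, H⁻¹ * ∫ t in (0 : ℝ)..H,
    f₂ (localClusterState Ψ R t z i) with hA₂
  -- pointwise on the good set
  have hpt : ∀ z ∈ Φ.good,
      ENNReal.ofReal (Real.exp (H⁻¹ * ∫ t in (0 : ℝ)..H, ∑ i, f (Φ.flow t z i))) ≤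
        2⁻¹ * (ENNReal.ofReal (Real.exp (A₂ z)) + ENNReal.ofReal (Real.exp (lam * bad z))) := by
    intro z hz
    have hcmp := TransferSkeleton.abs_window_true_sub_forecast_le Ψ Φ.flow R hH hf z
    have hle : H⁻¹ * ∫ t in (0 : ℝ)..H, ∑ i, f (Φ.flow t z i) ≤ 2⁻¹ * A₂ z + 2 * C * bad z := by
      have hA₂z : A₂ z = 2 * ∑ i, H⁻¹ * ∫ t in (0 : ℝ)..H, f (localClusterState Ψ R t z i) :=
        sum_window_double hf₂ (fun i t => localClusterState Ψ R t z i) H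
      rw [trueWindow_eq_sum Φ hz hfm hf H, hA₂z]
      have h1 := (abs_sub_le_iff.1 hcmp).1
      simp only [hbad]
      linarith
    calc ENNReal.ofReal (Real.exp (H⁻¹ * ∫ t in (0 : ℝ)..H, ∑ i, f (Φ.flow t z i)))
        ≤ ENNReal.ofReal (Real.exp (2⁻¹ * A₂ z + 2 * C * bad z)) :=
          ENNReal.ofReal_le_ofReal (Real.exp_le_exp.2 hle)
      _ ≤ 2⁻¹ * (ENNReal.ofReal (Real.exp (2 * (2⁻¹ * A₂ z))) +
            ENNReal.ofReal (Real.exp (2 * (2 * C * bad z)))) := ofReal_exp_add_le _ _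
      _ ≤ 2⁻¹ * (ENNReal.ofReal (Real.exp (A₂ z)) + ENNReal.ofReal (Real.exp (lam * bad z))) := by
          have e1 : 2 * (2⁻¹ * A₂ z) = A₂ z := by ring
          have e2 : 2 * (2 * C * bad z) = (4 * C) * bad z := by ring
          rw [e1, e2]
          gcongr 2⁻¹ * (_ + ?_)
          exact ofReal_exp_mul_le_of_le hlam (by positivity)
  -- integrate
  have hXm : AEMeasurable (fun z => ENNReal.ofReal (Real.exp (A₂ z))) μ :=
    (Real.measurable_exp.comp (TransferSkeleton.measurable_forecastWindow Ψ R H hf₂m)).ennreal_ofReal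
      |>.aemeasurable
  calc ∫⁻ z, ENNReal.ofReal (Real.exp (H⁻¹ * ∫ t in (0 : ℝ)..H, ∑ i, f (Φ.flow t z i))) ∂μ
      ≤ ∫⁻ z, 2⁻¹ * (ENNReal.ofReal (Real.exp (A₂ z)) + ENNReal.ofReal (Real.exp (lam * bad z))) ∂μ :=
        lintegral_mono_ae (hae.mono hpt)
    _ ≤ 2⁻¹ * (∫⁻ z, ENNReal.ofReal (Real.exp (A₂ z)) ∂μ +
          ∫⁻ z, ENNReal.ofReal (Real.exp (lam * bad z)) ∂μ) := lintegral_half_add_le hXm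

open scoped Classical in
/-- **Forecast window ≤ true window × locality (additive form).** For a law `μ` carried by the good set of
`Φ`, a measurable one-body observable `f` with `|f| ≤ C`, its double `f₂ = 2f` (measurable), a window `H > 0`,
a range `R` and an amplitude `lam ≥ 4C`:
`∫ exp(Σᵢ H⁻¹∫₀ᴴ f(ζ^{(i,R)}_t(z)) dt) dμ ≤ ½ (∫ exp(H⁻¹∫₀ᴴ Σᵢ f₂((Φ_t z)ᵢ) dt) dμ + ∫ exp(lam·#bad(z)) dμ)`.
[folklore] -/
theorem wl_forecastWindow_le : ∀ {N : ℕ} {ε : ℝ} (Φ : HardSphereFlow (Torus.geometry (Fin 3)) ε N)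
    (Ψ : (k : ℕ) → HardSphereFlow (Torus.geometry (Fin 3)) ε k) (μ : Measure (Config N (Fin 3) T3)),
    μ Φ.goodᶜ = 0 → ∀ (f f₂ : T3 × EuclideanSpace ℝ (Fin 3) → ℝ) (C H R lam : ℝ), Measurable f →
    Measurable f₂ → (∀ q, |f q| ≤ C) → (∀ q, f₂ q = 2 * f q) → 0 < H → 4 * C ≤ lam →
    ∫⁻ z, ENNReal.ofReal (Real.exp (∑ i, H⁻¹ * ∫ t in (0 : ℝ)..H,
        f (localClusterState Ψ R t z i))) ∂μ ≤
      2⁻¹ * (∫⁻ z, ENNReal.ofReal (Real.exp (H⁻¹ * ∫ t in (0 : ℝ)..H, ∑ i, f₂ (Φ.flow t z i))) ∂μ +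
        ∫⁻ z, ENNReal.ofReal (Real.exp (lam * ((Finset.univ.filter fun i : Fin N =>
          ∃ t ∈ Set.Icc (0 : ℝ) H, Φ.flow t z i ≠ localClusterState Ψ R t z i).card : ℝ))) ∂μ) := by
  intro N ε Φ Ψ μ hgood f f₂ C H R lam hfm hf₂m hf hf₂ hH hlam
  classical
  have hae : ∀ᵐ z ∂μ, z ∈ Φ.good := mem_ae_iff.2 hgood
  -- names
  set bad : Config N (Fin 3) T3 → ℝ := fun z => ((Finset.univ.filter fun i : Fin N =>
    ∃ t ∈ Set.Icc (0 : ℝ) H, Φ.flow t z i ≠ localClusterState Ψ R t z i).card : ℝ) with hbad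
  set B₂ : Config N (Fin 3) T3 → ℝ := fun z => H⁻¹ * ∫ t in (0 : ℝ)..H, ∑ i, f₂ (Φ.flow t z i)
    with hB₂
  -- pointwise on the good set
  have hpt : ∀ z ∈ Φ.good,
      ENNReal.ofReal (Real.exp (∑ i, H⁻¹ * ∫ t in (0 : ℝ)..H, f (localClusterState Ψ R t z i))) ≤
        2⁻¹ * (ENNReal.ofReal (Real.exp (B₂ z)) + ENNReal.ofReal (Real.exp (lam * bad z))) := by
    intro z hz
    have hcmp := TransferSkeleton.abs_window_true_sub_forecast_le Ψ Φ.flow R hH hf z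
    have hle : ∑ i, H⁻¹ * ∫ t in (0 : ℝ)..H, f (localClusterState Ψ R t z i) ≤
        2⁻¹ * B₂ z + 2 * C * bad z := by
      have hB₂z : B₂ z = 2 * ∑ i, H⁻¹ * ∫ t in (0 : ℝ)..H, f (Φ.flow t z i) := by
        simp only [hB₂]
        rw [trueWindow_double hf₂ (fun t => Φ.flow t z) H, trueWindow_eq_sum Φ hz hfm hf H]
      rw [hB₂z]
      have h1 := (abs_sub_le_iff.1 hcmp).2
      simp only [hbad]
      linarith
    calc ENNReal.ofReal (Real.exp (∑ i, H⁻¹ * ∫ t in (0 : ℝ)..H, f (localClusterState Ψ R t z i)))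
        ≤ ENNReal.ofReal (Real.exp (2⁻¹ * B₂ z + 2 * C * bad z)) :=
          ENNReal.ofReal_le_ofReal (Real.exp_le_exp.2 hle)
      _ ≤ 2⁻¹ * (ENNReal.ofReal (Real.exp (2 * (2⁻¹ * B₂ z))) +
            ENNReal.ofReal (Real.exp (2 * (2 * C * bad z)))) := ofReal_exp_add_le _ _
      _ ≤ 2⁻¹ * (ENNReal.ofReal (Real.exp (B₂ z)) + ENNReal.ofReal (Real.exp (lam * bad z))) := by
          have e1 : 2 * (2⁻¹ * B₂ z) = B₂ z := by ring
          have e2 : 2 * (2 * C * bad z) = (4 * C) * bad z := by ring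
          rw [e1, e2]
          gcongr 2⁻¹ * (_ + ?_)
          exact ofReal_exp_mul_le_of_le hlam (by positivity)
  -- integrate: the true window functional is a.e.-measurable under a law carried by the good set
  have hFm : Measurable fun z : Config N (Fin 3) T3 => ∑ i, f₂ (z i) :=
    Finset.measurable_sum _ fun i _ => hf₂m.comp (measurable_pi_apply i)
  have hXm : AEMeasurable (fun z => ENNReal.ofReal (Real.exp (B₂ z))) μ :=
    (Real.measurable_exp.comp_aemeasurable
      ((Φ.aemeasurable_intervalIntegral_comp_flow_torus hFm 0 H hgood).const_mul _)).ennreal_ofReal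
  calc ∫⁻ z, ENNReal.ofReal (Real.exp (∑ i, H⁻¹ * ∫ t in (0 : ℝ)..H,
        f (localClusterState Ψ R t z i))) ∂μ
      ≤ ∫⁻ z, 2⁻¹ * (ENNReal.ofReal (Real.exp (B₂ z)) + ENNReal.ofReal (Real.exp (lam * bad z))) ∂μ :=
        lintegral_mono_ae (hae.mono hpt)
    _ ≤ 2⁻¹ * (∫⁻ z, ENNReal.ofReal (Real.exp (B₂ z)) ∂μ +
          ∫⁻ z, ENNReal.ofReal (Real.exp (lam * bad z)) ∂μ) := lintegral_half_add_le hXm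

end WindowLocality

end Summit.AtomisticToContinuum.HydrodynamicLimit.Theorems

end
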